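import Mathlib
import HarnessLib

/-!
# Markman 2025 — the Chern-character arithmetic on the secant line through `exp(√−d Θ)` ([M] §8.2–§8.3),
# AS PRINTED and kernel-checked in the `Θ`-subalgebra of `H^{2•}(X, ℚ)`

E. Markman: [M] *Cycles on abelian 2n-folds of Weil type from secant sheaves on abelian n-folds*,
arXiv:2502.03415 **v2** (2025-06-08), bib `Markman2025SecantWeil` — UNREFEREED PREPRINT; [S] *Secant sheaves and
Weil classes on abelian varieties*, arXiv:2509.23403 **v2** (2026-02-11), bib `Markman2025SurveySecant` — the survey
(the results it reports remain PREPRINT). Pages/lines are PyMuPDF lines of the public arXiv PDFs (v2 of [M]: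
sha256/16 `8155aa33870069b8`; v2 of [S]: `3151aee3307548da`), read at seat lit-w-markman (pub-hsemireg, 2026-08-23).

## What is printed (verbatim; `X = Pic^{g−1}(C)` the Jacobian of a non-hyperelliptic curve `C` of genus `g`,
## `Θ` its theta divisor, `[pt]` the point class, `[W_k]` the class of a translate of the Abel–Jacobi image of `C^{(k)}`)

* [M] v2 (1.2.3), p. 4 L8–13: «`(s, t)_S := ∫_X τ(s) ∪ t`, where the main anti-automorphism `τ` acts via
  multiplication by `(−1)^{i(i−1)/2}` on `H^i(X, ℤ)`.»
* GENUS 3. [M] v2 p. 52 L3–21: «Let `d` be a positive integer. Set `α := 1 − (d/2)Θ²` and `β := Θ − d[pt]`. We have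
  `exp(√−dΘ) = 1 + √−dΘ − (d/2)Θ² − d√−d[pt] = (1 − (d/2)Θ²) + √−d(Θ − d[pt]) = α + √−dβ`.»; p. 52 L28–29 «Let
  `t_i`, `1 ≤ i ≤ d+1`, be distinct points of `Pic¹(C)` and set `C_i := C_{t_i}`.»  LEMMA 8.2.1 (p. 52 L30–38):
  «Assume that `C_i`, `1 ≤ i ≤ d + 1`, are pairwise disjoint. Then the following equality holds
  `ch(I_{∪_{i=1}^{d+1} C_i} ⊗ O_X(Θ)) = 1 + Θ − (d/2)Θ² − d[pt] = α + β`.»  PROOF (p. 52 L56–75): «The equality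
  `ch(O_{C_i}) = Θ²/2 − 2[pt]` holds, since `χ(O_{C_i}) = −2`. Hence, given `n` disjoint translates `C_i` of `AJ(C)`,
  we get `ch(I_{∪_{i=1}^n C_i}) = 1 − n(Θ²/2 − 2[pt]) = 1 − (n/2)Θ² + 2n[pt]`. Then
  `ch(I_{∪ C_i} ⊗ O_X(kΘ)) = (1 − (n/2)Θ² + 2n[pt])(1 + kΘ + (k²/2)Θ² + k³[pt]) = 1 + kΘ + ((k² − n)/2)Θ² +
  (k³ − 3kn + 2n)[pt]`. Taking `k = 1` and `n = d + 1` we get the desired equality.»  [M] §8.3, p. 56 L16–24: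
  «Set `F₁ := I_{∪_{i=1}^{d+1} C_i} ⊗ O_X(Θ)`. Let `P := span{α, β}` be the rational `ℚ(√−d)`-secant plane.
  Assumption 2.4.1 is satisfied, since `(α, β)_S = ∫_X τ(α) ∪ β = ∫_X α ∪ β = −4d ≠ 0`.»  Survey twin, [S] v2 p. 18
  L14–21: «The class Poincaré dual to `C_i` is `Θ²/2 ∈ H^{2,2}(X, ℤ)` and one checks that
  `ch(F₁) = (1 − (q/2)Θ²) + (Θ − (q/3!)Θ³)`, which belongs to the secant `B = span_ℚ{α, β}`, `α = 1 − (q/2)Θ²`,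
  `β = Θ − (q/3!)Θ³`, associated to the pure spinor `exp(√−qΘ)` … (see [M2, Lem 8.2.1] for the computation of
  `ch(F₁)`)»; p. 18 L30–31: «Note that `ch(F_i^∨) = α − β` is in `B` as well, where `F_i^∨` is the derived dual object.»
* GENUS 4 (EXAMPLE 8.2.3, [M] v2 p. 52 L88 – p. 53 L105; `X := Pic^{n−1}(C)`, `n = 4`). p. 52 L93–94: «Then
  `[W_k] = Θ^{n−k}/(n−k)!`, by Poincaré's formula.»; p. 53 L3–17: «Let `F := I_Z(a_{n−1}Θ)` … Let `α` be the real part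
  of `exp(√−dΘ)` and `√d β` its imaginary part. `α := 1 − d[W_{n−2}] + d²[W_{n−4}] + ⋯ + (−d)^{n/2}[pt]`,
  `β := Θ − d[W_{n−3}] + ⋯` The integers `a_k`, `0 ≤ k ≤ n − 1`, in (8.2.1) should be chosen to satisfy the equation
  (8.2.2) `ch(F) = α + a_{n−1}β`.»; p. 53 L18–28: «For example, when `n = 4` we may assume that only the irreducible
  components of `Z` in (8.2.1), which are translates of `W₂`, intersect and every such pair interests [sic] at
  `Θ⁴/4 = 6` points. Note that `χ(O_{W₁}) = χ(O_C) = −3` and `χ(O_{W₂}) = 3`. For the latter equality use that `C` is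
  non-hyperelliptic to conclude that `W₂` is isomorphic to `C^{(2)}`, as well as the equalities `h^{0,1}(C^{(2)}) = 4`
  and `h^{0,2}(C^{(2)}) = 6`. We get `ch(O_{W₁}) = Θ³/6 − 3[pt]`, `ch(O_{W₂}) = Θ²/2 − Θ³/3 + 3[pt]` (see Lemma
  8.2.5),»; p. 53 L29–56: «`ch(O_Z) = Σ_{k=0}^{2} a_k ch(O_{W_k}) − 6·binom(a₂, 2)[pt]`,
  `ch(I_Z) = 1 − (a₂/2)Θ² + ((2a₂ − a₁)/6)Θ³ + (6·binom(a₂, 2) − 3a₂ + 3a₁ − a₀)[pt]`,»; p. 53 L57–85: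
  «`ch(I_Z(a₃Θ)) = 1 + a₃Θ + ((a₃² − a₂)/2)Θ² + ((a₃³ − 3a₃a₂ + 2a₂ − a₁)/6)Θ³ + (a₃⁴ − 6a₂a₃² + 8a₂a₃ − 4a₁a₃ +
  6·binom(a₂, 2) − 3a₂ + 3a₁ − a₀)[pt]`, `α + a₃β = 1 + a₃Θ − (d/2)Θ² − (da₃/6)Θ³ + d²[pt]`»; p. 53 L86–96:
  «Comparing coefficients in Equation 8.2.2 we get `a₂ = d + a₃²`, `a₁ = 2(d + a₃²)(1 − a₃)`,
  `a₀ = 6a₃⁴ − 6a₃³ + 8da₃² − 6da₃ + 2d² = (a₃² + d)(6a₃² − 6a₃ + 2d)`. We get a secant ideal sheaf tensored with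
  `O_X(a₃Θ)` for every choice of an integer `a₃ ≤ 1`. If we choose `a₃ = 1`, then `a₂ = d + 1`, `a₁ = 0`, and
  `a₀ = 2d(d + 1)`.»; p. 53 L99–105: «However, `F_d := I_Z(Θ)` is unlikely to be semiregular, and the semiregularity
  map could restrict to `Ext²(F_d, F_d)^G` as an injective map for at most finitely many values of `d`, since
  `dim Ext²(F_d, F_d) = ∫_X ch(F_d)ch(F_d^∨) + 2 dim Ext¹(F_d, F_d) − 2 = 8d(d + 1) − 2 + 2 dim Ext¹(F_d, F_d)` grows
  quadratically with `d`, while the order of `G` is linear in `d`.»  LEMMA 8.2.5 (p. 55 L52–62): «We have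
  `ch(O_{W₂}) = Θ²/2 − Θ³/3 + 3[pt]` in the notation of Example 8.2.3. Proof. We have `ch(O_{W₂}) = Θ²/2 + λΘ³ + 3[pt]`,
  for some rational number `λ` satisfying (8.2.4) `χ(O_{W₂}(−Θ)) = ∫_X (Θ²/2 + λΘ³ + 3[pt])(1 − Θ + Θ²/2 − Θ³/6 +
  Θ⁴/24) = 9 − 24λ`,»; p. 56 L10–13: «`χ(O_{W₂ ∩ τ_{p−q₁−q₂}(Θ)}) = χ(O_{C₁}) + χ(O_{C₂}) + χ(O_{C₃}) − 5 = −14`.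
  `χ(O_{W₂}(−τ_{p−q₁−q₂}(Θ))) = χ(O_{W₂}) − χ(O_{W₂ ∩ τ_{p−q₁−q₂}(Θ)}) = 17`. Comparing with (8.2.4) we get
  `9 − 24λ = 17`, so `λ = −1/3`.»

## The model (standard; every input is BY VALUE)
For a PRINCIPALLY polarized abelian `g`-fold `(X, Θ)` the sub-`ℚ`-algebra `ℚ[Θ] ⊂ H^{2•}(X, ℚ)` has basis
`Θ^j/j!` (`0 ≤ j ≤ g`), with `Θ^g/g! = [pt]` and, on a Jacobian, `Θ^j/j! = [W_{g−j}]` (Poincaré's formula, [M] p. 52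
L93–94); cup product `(Θ^i/i!)(Θ^j/j!) = binom(i+j, i)·Θ^{i+j}/(i+j)!` (zero for `i + j > g`), and `∫_X` = the
`[pt]`-coordinate (the same coordinates `v_j` as in the tree files `HodgeTheory/SemiregularityEulerForm*`). `Theta3 K` /
`Theta4 K` below ARE these coordinate algebras for `g = 3` / `g = 4` over a field `K`
of characteristic `0` (to host `√−d`): a 4- resp. 5-tuple with that multiplication — nothing about `X` is formalised.
`exp c` is the (exact, since `Θ^{g+1} = 0`) exponential `Σ_j c^j Θ^j/j!`; `tau` is [M] (1.2.3) on even degrees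
(`(−1)^j` on `H^{2j}`), which is also the sign rule `ch_j(F^∨) = (−1)^j ch_j(F)` of the derived dual ([S] p. 18 L30–31
prints the genus-3 instance `ch(F_i^∨) = α − β`).

## What this file proves (kernel-checked arithmetic of the sentences above; NO named fact; nothing geometric)
genus 3: `exp(√−dΘ) = α + √−dβ`; Lemma 8.2.1's product formula for all `n, k` and its case `k = 1, n = d + 1`;
`∫ ch(O_{C_i}) = −2`; `τ(α) = α`, `(α, β)_S = ∫ α ∪ β = −4d ≠ 0`; the survey's `β = Θ − (q/3!)Θ³` and `ch(F^∨) = α − β`;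
(1.2.3) is anti-symmetric on the `Θ`-subalgebra (`(x, x)_S = 0`).
genus 4: `exp(√−dΘ) = α + √−dβ` with `α = 1 − d[W₂] + d²[pt]`, `β = Θ − d[W₁]`; `[W₂]² = Θ⁴/4 = 6[pt]`;
`χ(O_{W₁}) = ∫ch = −3`, `χ(O_{W₂}) = ∫ch = 3 = 1 − 4 + 6`; Lemma 8.2.5's `(8.2.4) = 9 − 24λ`, `[W₂]·Θ = 3[W₁]`,
`1 + 2 + 2 = 5`, `−3−3−3−5 = −14`, `3 − (−14) = 17`, `9 − 24λ = 17 ⟺ λ = −1/3`; the displayed `ch(I_Z)`, `ch(I_Z(a₃Θ))`,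
`α + a₃β`; «comparing coefficients» as an IFF with the printed solution, the factorisation of `a₀`, the case `a₃ = 1`,
and the sign bookkeeping `a₂, a₀ > 0`, `a₁ ≥ 0 ⟺ a₃ ≤ 1` behind «an integer `a₃ ≤ 1`»; (1.2.3) is symmetric with
`(x, x)_S = 2x₀x₄ − 8x₁x₃ + 6x₂²` (the Euler form of `HodgeTheory/SemiregularityEulerFormBarrier`), and
`∫ ch(F_d)·τ(ch F_d) = 8d(d+1)` (`8d(a₃² + d)` for `I_Z(a₃Θ)`, = that file's `eulerForm_twistedIdeal`; its
`ext_two_eq_euler` is the Serre-duality step `dim Ext² = χ + 2 dim Ext¹ − 2`, not repeated here).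
§8.1 (v2 p. 50 L66 – p. 51 L70; last section of this file): the general `K`-secant pure spinors
`qⁿ·exp(kΘ) = α + τ√−d·β`, `qk = ρ + τ√−d`, with the printed coordinate lists of `α`, `β` for `n = 2, 3, 4`
(`Theta2` is the 3-coordinate surface model), the printed closed forms, the case list «`χ(F^∨ ⊗ F) = 0` (n odd),
`−2q²(a²τ²d + b²)` (n = 2), `8dq⁴τ²(a²τ²d + b²)` (n = 4)», and ONE PRINT ERRATUM certified: the first display line of
`β` has `ρ(ρ² − τ²d)Θ⁴/4!` where `β`'s own closed form (and `exp(kΘ)`) give `ρ(ρ² − τ²d)Θ⁴/3!`.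

## Inputs BY VALUE (printed or standard; NOT proved here) and honest framing
`ch(O_{C_i}) = Θ²/2 − 2[pt]`, `ch(O_{W₁})`, `ch(O_{W₂})` (as classes of SHEAVES), the additivity of `ch` over the
disjoint unions / the `6·binom(a₂,2)` pairwise intersection points, `χ = ∫ ch` (HRR with `td(X) = 1`),
`ch(F^∨) = τ(ch F)`, Poincaré's formula, the existence and genericity of the curves/points — all enter as the printed VALUES; the kernel adds only the
ring arithmetic in `ℚ[Θ]/(Θ^{g+1})`. This is bookkeeping of printed elementary steps for seats that re-derive
Markman's secant objects (rows M-Mk1/M-Mk10 and scope line (S8) of the pub-hsemireg LIT-W table: Example 8.2.3 is the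
one printed `n = 4` secant IDEAL SHEAF, of which print says «unlikely to be semiregular»); it says nothing about
semiregularity or the Hodge conjecture and re-proves no theorem of [M]/[S].
-/

namespace Literature.AlgebraicGeometry.Markman2025

/-! ## Genus 3: the algebra `K[Θ]/(Θ⁴)`, basis `1, Θ, Θ²/2! = [C], Θ³/3! = [pt]` -/

/-- Coordinates `(c0, c1, c2, c3) ↔ c0·1 + c1·Θ + c2·Θ²/2! + c3·Θ³/3!` of a class in the `Θ`-subalgebra of
`H^{2•}(X, K)`, `(X, Θ)` a principally polarized abelian THREEFOLD (`Θ³/3! = [pt]`; on a genus-3 Jacobian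
`Θ²/2! = [AJ(C)]`). [cite: Markman2025SecantWeil, Example 8.2.3, v2 p. 52 L93–94 (Poincaré's formula, by value)] -/
@[ext] structure Theta3 (K : Type*) where
  /-- coefficient of `1` -/
  c0 : K
  /-- coefficient of `Θ` -/
  c1 : K
  /-- coefficient of `Θ²/2!` -/
  c2 : K
  /-- coefficient of `Θ³/3! = [pt]` -/
  c3 : K

namespace Theta3

variable {K : Type*}

/-- `∫_X` : the `[pt]`-coordinate (`∫_X [pt] = 1`). [folklore] -/
def integral (x : Theta3 K) : K := x.c3

/-- unfolding `∫_X` on a coordinate vector. [folklore] -/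
@[simp] private theorem integral_mk (a b c e : K) : integral (⟨a, b, c, e⟩ : Theta3 K) = e := rfl

variable [Field K]

/-- zero class -/
@[simps] instance : Zero (Theta3 K) := ⟨⟨0, 0, 0, 0⟩⟩
/-- `1 ∈ H⁰` -/
@[simps] instance : One (Theta3 K) := ⟨⟨1, 0, 0, 0⟩⟩
/-- sum of classes -/
@[simps] instance : Add (Theta3 K) := ⟨fun x y => ⟨x.c0 + y.c0, x.c1 + y.c1, x.c2 + y.c2, x.c3 + y.c3⟩⟩
/-- negative -/
@[simps] instance : Neg (Theta3 K) := ⟨fun x => ⟨-x.c0, -x.c1, -x.c2, -x.c3⟩⟩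
/-- difference -/
@[simps] instance : Sub (Theta3 K) := ⟨fun x y => ⟨x.c0 - y.c0, x.c1 - y.c1, x.c2 - y.c2, x.c3 - y.c3⟩⟩
/-- scalars -/
@[simps] instance : SMul K (Theta3 K) := ⟨fun a x => ⟨a * x.c0, a * x.c1, a * x.c2, a * x.c3⟩⟩
/-- cup product in the divided-power basis: `(Θ^i/i!)(Θ^j/j!) = binom(i+j,i) Θ^{i+j}/(i+j)!`, `Θ⁴ = 0`. -/
@[simps] instance : Mul (Theta3 K) := ⟨fun x y => ⟨x.c0 * y.c0, x.c0 * y.c1 + x.c1 * y.c0,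
    x.c0 * y.c2 + 2 * (x.c1 * y.c1) + x.c2 * y.c0,
    x.c0 * y.c3 + 3 * (x.c1 * y.c2) + 3 * (x.c2 * y.c1) + x.c3 * y.c0⟩⟩

/-- `Θ` (coordinates `(0,1,0,0)`). [folklore] -/
@[simps] def theta : Theta3 K := ⟨0, 1, 0, 0⟩
/-- `Θ² = 2!·(Θ²/2!)`. [folklore] -/
@[simps] def thetaSq : Theta3 K := ⟨0, 0, 2, 0⟩
/-- `Θ³ = 3!·[pt]` (principal polarization: `deg Θ³ = 3!`). [folklore]
[cite: Markman2025SecantWeil, Example 8.2.3, v2 p. 52 L93–94 (Poincaré's formula, by value)] -/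
@[simps] def thetaCube : Theta3 K := ⟨0, 0, 0, 6⟩
/-- `[pt] = Θ³/3!`. [folklore] [cite: Markman2025SecantWeil, Example 8.2.3, v2 p. 52 L93–94 (Poincaré's formula, by value)] -/
@[simps] def pt : Theta3 K := ⟨0, 0, 0, 1⟩
/-- [M] (1.2.3): `τ = (−1)^{i(i−1)/2}` on `H^i`, i.e. `(−1)^j` on `H^{2j}`; also the sign rule of `ch(F^∨)`.
[cite: Markman2025SecantWeil, (1.2.3), v2 p. 4 L8–13] -/
@[simps] def tau (x : Theta3 K) : Theta3 K := ⟨x.c0, -x.c1, x.c2, -x.c3⟩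
/-- `exp(cΘ) = Σ_j c^j Θ^j/j!` (exact: `Θ⁴ = 0`); `ch(O_X(kΘ)) = exp(kΘ)`. [folklore]
[cite: Markman2025SecantWeil, §8.2, v2 p. 52 L3–21 and L64–70 (the printed expansions of `exp(√−dΘ)`, `exp(kΘ)`)] -/
@[simps] def exp (c : K) : Theta3 K := ⟨1, c, c ^ 2, c ^ 3⟩
/-- [M] p. 52 L3–4: `α := 1 − (d/2)Θ²`. [cite: Markman2025SecantWeil, §8.2, v2 p. 52 L3–4] -/
def alpha (d : K) : Theta3 K := 1 - (d / 2) • thetaSq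
/-- [M] p. 52 L4: `β := Θ − d[pt]`. [cite: Markman2025SecantWeil, §8.2, v2 p. 52 L3–4] -/
def beta (d : K) : Theta3 K := theta - d • pt
/-- INPUT BY VALUE, [M] p. 52 L56: «The equality `ch(O_{C_i}) = Θ²/2 − 2[pt]` holds, since `χ(O_{C_i}) = −2`.»
[cite: Markman2025SecantWeil, proof of Lemma 8.2.1, v2 p. 52 L56] -/
def chOC : Theta3 K := (1 / 2 : K) • thetaSq - (2 : K) • pt

/-- `χ(O_{C_i}) = ∫_X ch(O_{C_i}) = −2` (HRR, `td(X) = 1`; the printed consistency «since `χ(O_{C_i}) = −2`»).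
[cite: Markman2025SecantWeil, proof of Lemma 8.2.1, v2 p. 52 L56] -/
theorem integral_chOC : integral (chOC : Theta3 K) = -2 := by
  simp [chOC, integral]

/-- **[S] v2 p. 18 L30–31** «Note that `ch(F_i^∨) = α − β` is in `B` as well, where `F_i^∨` is the derived dual
object.» (and [M] Lemma 8.2.1, p. 52 L39–55: `ch(RHom(I_{∪C_i} ⊗ O_X(Θ), O_X))` lies on the same secant line): with
`ch(F^∨) = τ(ch F)` (sign `(−1)^j` on `H^{2j}`, [M] (1.2.3)), `τ(α + β) = α − β ∈ span{α, β}`.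
[cite: Markman2025SurveySecant, §11.1, v2 p. 18 L30–31] [cite: Markman2025SecantWeil, Lemma 8.2.1, v2 p. 52 L39–55] -/
theorem tau_alpha_add_beta (d : K) : tau (alpha d + beta d) = alpha d - beta d := by
  ext <;> simp [alpha, beta]

/-- **[M] (1.2.3), v2 p. 4 L5–13** «… a non-degenerate integral bilinear pairing, which is symmetric for even `n`
and anti-symmetric for odd `n` (1.2.3) `(s, t)_S := ∫_X τ(s) ∪ t`»: for `n = 3` the pairing is ANTI-symmetric on the
`Θ`-subalgebra, in particular `(x, x)_S = 0` for every class — the model face of `χ(F, F) = 0` on an abelian threefold.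
[cite: Markman2025SecantWeil, (1.2.3), v2 p. 4 L5–13] -/
theorem mukaiPairing_three (x y : Theta3 K) :
    integral (tau x * y) = -integral (tau y * x) ∧ integral (tau x * x) = 0 := by
  constructor <;> simp [integral] <;> ring

variable [CharZero K]

/-- Model sanity: `Θ·Θ = Θ²`, `Θ·Θ² = Θ³ = 3!·[pt]`, `Θ·[pt] = 0`, `∫[pt] = 1`, `∫Θ³ = 3! = 6`, and `exp` is the
exponential series. [cite: Markman2025SecantWeil, Example 8.2.3, v2 p. 52 L93–94 (Poincaré's formula `[W_k] =
Θ^{n−k}/(n−k)!`, principal polarization; by value)] -/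
theorem model_sanity (c : K) :
    theta * theta = (thetaSq : Theta3 K) ∧ theta * thetaSq = (thetaCube : Theta3 K) ∧
    (thetaCube : Theta3 K) = (6 : K) • pt ∧ theta * pt = (0 : Theta3 K) ∧ integral (pt : Theta3 K) = 1 ∧
    integral (thetaCube : Theta3 K) = 6 ∧
    exp c = 1 + c • theta + (c ^ 2 / 2) • thetaSq + (c ^ 3 / 6) • thetaCube := by
  refine ⟨?_, ?_, ?_, ?_, rfl, rfl, ?_⟩ <;> ext <;> simp
  ring

/-- **[M] v2 p. 52 L3–21** «`exp(√−dΘ) = 1 + √−dΘ − (d/2)Θ² − d√−d[pt] = (1 − (d/2)Θ²) + √−d(Θ − d[pt]) = α + √−dβ`»: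
for any `s` with `s² = −d`, `exp(sΘ) = α + s·β`. [cite: Markman2025SecantWeil, §8.2, v2 p. 52 L3–21] -/
theorem exp_sqrt_neg (d s : K) (hs : s ^ 2 = -d) : exp s = alpha d + s • beta d := by
  ext <;> simp [alpha, beta]
  · linear_combination hs
  · linear_combination s * hs

/-- **[M] v2 p. 52 L56–63** (proof of Lemma 8.2.1): «given `n` disjoint translates `C_i` of `AJ(C)`, we get
`ch(I_{∪_{i=1}^n C_i}) = 1 − n(Θ²/2 − 2[pt]) = 1 − (n/2)Θ² + 2n[pt]`» — with `ch(O_{C_i}) = Θ²/2 − 2[pt]` and the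
additivity over the disjoint union as inputs by value, the displayed simplification.
[cite: Markman2025SecantWeil, proof of Lemma 8.2.1, v2 p. 52 L56–63] -/
theorem ch_ideal_disjoint_translates (n : K) :
    1 - n • chOC = (1 : Theta3 K) - (n / 2) • thetaSq + (2 * n) • pt := by
  ext <;> simp [chOC]
  ring

/-- **[M] v2 p. 52 L64–74, the general product formula in the proof of LEMMA 8.2.1**:
«`ch(I_{∪_{i=1}^n C_i} ⊗ O_X(kΘ)) = (1 − (n/2)Θ² + 2n[pt])(1 + kΘ + (k²/2)Θ² + k³[pt])
 = 1 + kΘ + ((k² − n)/2)Θ² + (k³ − 3kn + 2n)[pt]`» (`ch(O_X(kΘ)) = exp(kΘ)`, `Θ³ = 6[pt]`).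
[cite: Markman2025SecantWeil, proof of Lemma 8.2.1, v2 p. 52 L64–74] -/
theorem lemma_8_2_1_product (n k : K) :
    ((1 : Theta3 K) - (n / 2) • thetaSq + (2 * n) • pt) * exp k
      = 1 + k • theta + ((k ^ 2 - n) / 2) • thetaSq + (k ^ 3 - 3 * k * n + 2 * n) • pt := by
  ext <;> simp <;> ring

/-- **[M] LEMMA 8.2.1, v2 p. 52 L30–38 with L75** «Taking `k = 1` and `n = d + 1` we get the desired equality»:
`ch(I_{∪_{i=1}^{d+1} C_i} ⊗ O_X(Θ)) = 1 + Θ − (d/2)Θ² − d[pt] = α + β` (coordinates `(1, 1, −d, −d)`, cf. the bare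
coordinate identities `HodgeTheory.SecantTangentDichotomy.genusThree_sum_of_tangents`).
[cite: Markman2025SecantWeil, Lemma 8.2.1, v2 p. 52 L30–38 and L75] -/
theorem lemma_8_2_1 (d : K) :
    ((1 : Theta3 K) - ((d + 1) / 2) • thetaSq + (2 * (d + 1)) • pt) * exp 1
      = 1 + theta - (d / 2) • thetaSq - d • pt ∧
    (1 : Theta3 K) + theta - (d / 2) • thetaSq - d • pt = alpha d + beta d := by
  constructor <;> ext <;> simp [alpha, beta]
  ring

/-- **[S] v2 p. 18 L14–21, the survey's form** «`ch(F₁) = (1 − (q/2)Θ²) + (Θ − (q/3!)Θ³)` … `α = 1 − (q/2)Θ²`,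
`β = Θ − (q/3!)Θ³`»: `β` of [M] (`Θ − q[pt]`) equals `Θ − (q/3!)Θ³`, and `α + β` is the class of Lemma 8.2.1.
[cite: Markman2025SurveySecant, §11.1, v2 p. 18 L14–21] -/
theorem survey_secant_classes (q : K) :
    beta q = theta - (q / 6) • (thetaCube : Theta3 K) ∧
    alpha q + beta q = ((1 : Theta3 K) - (q / 2) • thetaSq) + (theta - (q / 6) • thetaCube) := by
  constructor <;> ext <;> simp [alpha, beta]

/-- **[M] §8.3, v2 p. 56 L16–24** «Assumption 2.4.1 is satisfied, since `(α, β)_S = ∫_X τ(α) ∪ β = ∫_X α ∪ β =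
−4d ≠ 0`»: `τ(α) = α` and both integrals equal `−4d` (non-vanishing for `d ≠ 0` in characteristic `0`).
[cite: Markman2025SecantWeil, §8.3, v2 p. 56 L16–24] -/
theorem secant_pairing_alpha_beta (d : K) :
    tau (alpha d) = alpha d ∧ integral (tau (alpha d) * beta d) = -4 * d ∧
    integral (alpha d * beta d) = -4 * d ∧ (d ≠ 0 → integral (alpha d * beta d) ≠ 0) := by
  have h3 : integral (alpha d * beta d) = -4 * d := by
    simp [alpha, beta, integral]; ring
  refine ⟨?_, ?_, h3, fun hd => ?_⟩
  · ext <;> simp [alpha]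
  · simp [alpha, beta, integral]; ring
  · rw [h3]; exact mul_ne_zero (by norm_num) hd

end Theta3

/-! ## Genus 4 (Example 8.2.3 with `n = 4`, Lemma 8.2.5): the algebra `K[Θ]/(Θ⁵)`,
basis `1, Θ, Θ²/2! = [W₂], Θ³/3! = [W₁], Θ⁴/4! = [W₀] = [pt]` -/

/-- Coordinates `(c0, …, c4) ↔ Σ_j c_j·Θ^j/j!` of a class in the `Θ`-subalgebra of `H^{2•}(X, K)`, `(X, Θ)` a
principally polarized abelian FOURFOLD; on `X = Pic³(C)`, `C` of genus 4, `Θ^j/j! = [W_{4−j}]`.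
[cite: Markman2025SecantWeil, Example 8.2.3, v2 p. 52 L93–94 (Poincaré's formula, by value)] -/
@[ext] structure Theta4 (K : Type*) where
  /-- coefficient of `1` -/
  c0 : K
  /-- coefficient of `Θ` -/
  c1 : K
  /-- coefficient of `Θ²/2! = [W₂]` -/
  c2 : K
  /-- coefficient of `Θ³/3! = [W₁]` -/
  c3 : K
  /-- coefficient of `Θ⁴/4! = [pt]` -/
  c4 : K

namespace Theta4

variable {K : Type*}

/-- `∫_X` : the `[pt]`-coordinate (`∫_X [pt] = 1`). [folklore] -/
def integral (x : Theta4 K) : K := x.c4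

/-- unfolding `∫_X` on a coordinate vector. [folklore] -/
@[simp] private theorem integral_mk (a b c e f : K) : integral (⟨a, b, c, e, f⟩ : Theta4 K) = f := rfl

variable [Field K]

/-- zero class -/
@[simps] instance : Zero (Theta4 K) := ⟨⟨0, 0, 0, 0, 0⟩⟩
/-- `1 ∈ H⁰` -/
@[simps] instance : One (Theta4 K) := ⟨⟨1, 0, 0, 0, 0⟩⟩
/-- sum of classes -/
@[simps] instance : Add (Theta4 K) :=
  ⟨fun x y => ⟨x.c0 + y.c0, x.c1 + y.c1, x.c2 + y.c2, x.c3 + y.c3, x.c4 + y.c4⟩⟩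
/-- negative -/
@[simps] instance : Neg (Theta4 K) := ⟨fun x => ⟨-x.c0, -x.c1, -x.c2, -x.c3, -x.c4⟩⟩
/-- difference -/
@[simps] instance : Sub (Theta4 K) :=
  ⟨fun x y => ⟨x.c0 - y.c0, x.c1 - y.c1, x.c2 - y.c2, x.c3 - y.c3, x.c4 - y.c4⟩⟩
/-- scalars -/
@[simps] instance : SMul K (Theta4 K) := ⟨fun a x => ⟨a * x.c0, a * x.c1, a * x.c2, a * x.c3, a * x.c4⟩⟩
/-- cup product in the divided-power basis: `(Θ^i/i!)(Θ^j/j!) = binom(i+j,i) Θ^{i+j}/(i+j)!`, `Θ⁵ = 0`. -/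
@[simps] instance : Mul (Theta4 K) := ⟨fun x y => ⟨x.c0 * y.c0, x.c0 * y.c1 + x.c1 * y.c0,
    x.c0 * y.c2 + 2 * (x.c1 * y.c1) + x.c2 * y.c0,
    x.c0 * y.c3 + 3 * (x.c1 * y.c2) + 3 * (x.c2 * y.c1) + x.c3 * y.c0,
    x.c0 * y.c4 + 4 * (x.c1 * y.c3) + 6 * (x.c2 * y.c2) + 4 * (x.c3 * y.c1) + x.c4 * y.c0⟩⟩

/-- `Θ` (coordinates `(0,1,0,0,0)`). [folklore] -/
@[simps] def theta : Theta4 K := ⟨0, 1, 0, 0, 0⟩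
/-- `Θ² = 2!·[W₂]`. [folklore] -/
@[simps] def thetaSq : Theta4 K := ⟨0, 0, 2, 0, 0⟩
/-- `Θ³ = 3!·[W₁]`. [folklore] -/
@[simps] def thetaCube : Theta4 K := ⟨0, 0, 0, 6, 0⟩
/-- `Θ⁴ = 4!·[pt]` (principal polarization: `deg Θ⁴ = 4!`). [folklore]
[cite: Markman2025SecantWeil, Example 8.2.3, v2 p. 52 L93–94 (Poincaré's formula, by value)] -/
@[simps] def thetaFourth : Theta4 K := ⟨0, 0, 0, 0, 24⟩
/-- `[W₂] = Θ²/2!` («`[W_k] = Θ^{n−k}/(n−k)!`, by Poincaré's formula», `n = 4`). [folklore]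
[cite: Markman2025SecantWeil, Example 8.2.3, v2 p. 52 L93–94] -/
@[simps] def W2 : Theta4 K := ⟨0, 0, 1, 0, 0⟩
/-- `[W₁] = Θ³/3!` (the class of `AJ(C)`; Poincaré's formula). [folklore]
[cite: Markman2025SecantWeil, Example 8.2.3, v2 p. 52 L93–94] -/
@[simps] def W1 : Theta4 K := ⟨0, 0, 0, 1, 0⟩
/-- `[pt] = [W₀] = Θ⁴/4!`. [folklore] [cite: Markman2025SecantWeil, Example 8.2.3, v2 p. 52 L93–94] -/
@[simps] def pt : Theta4 K := ⟨0, 0, 0, 0, 1⟩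
/-- [M] (1.2.3) on even degrees: `(−1)^j` on `H^{2j}`; also the sign rule of `ch(F^∨)`.
[cite: Markman2025SecantWeil, (1.2.3), v2 p. 4 L8–13] -/
@[simps] def tau (x : Theta4 K) : Theta4 K := ⟨x.c0, -x.c1, x.c2, -x.c3, x.c4⟩
/-- `exp(cΘ) = Σ_j c^j Θ^j/j!` (exact: `Θ⁵ = 0`); `ch(O_X(kΘ)) = exp(kΘ)`. [folklore]
[cite: Markman2025SecantWeil, Lemma 8.2.5, v2 p. 55 L56–62 (the printed expansion `1 − Θ + Θ²/2 − Θ³/6 + Θ⁴/24` of `exp(−Θ)`)] -/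
@[simps] def exp (c : K) : Theta4 K := ⟨1, c, c ^ 2, c ^ 3, c ^ 4⟩
/-- [M] p. 53 L9–11 with `n = 4`: `α := 1 − d[W₂] + d²[pt]` (real part of `exp(√−dΘ)`).
[cite: Markman2025SecantWeil, Example 8.2.3, v2 p. 53 L4–14] -/
def alpha (d : K) : Theta4 K := 1 - d • W2 + (d ^ 2) • pt
/-- [M] p. 53 L12–14 with `n = 4`: `β := Θ − d[W₁]` (`√d·β` = imaginary part of `exp(√−dΘ)`).
[cite: Markman2025SecantWeil, Example 8.2.3, v2 p. 53 L4–14] -/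
def beta (d : K) : Theta4 K := theta - d • W1
/-- INPUT BY VALUE, [M] p. 53 L23–25: `ch(O_{W₁}) = Θ³/6 − 3[pt]`.
[cite: Markman2025SecantWeil, Example 8.2.3, v2 p. 53 L23–25] -/
def chOW1 : Theta4 K := (1 / 6 : K) • thetaCube - (3 : K) • pt
/-- INPUT BY VALUE, [M] p. 53 L26–28 = LEMMA 8.2.5 (p. 55 L52–53): `ch(O_{W₂}) = Θ²/2 − Θ³/3 + 3[pt]`.
[cite: Markman2025SecantWeil, Lemma 8.2.5, v2 p. 55 L52–53] -/
def chOW2 : Theta4 K := (1 / 2 : K) • thetaSq - (1 / 3 : K) • thetaCube + (3 : K) • pt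
/-- [M] p. 53 L29–39: «`ch(O_Z) = Σ_{k=0}^{2} a_k ch(O_{W_k}) − 6·binom(a₂, 2)[pt]`» (`ch(O_{W₀}) = [pt]`;
`binom(a₂, 2) = a₂(a₂ − 1)/2`; the `a_k` are the printed integer multiplicities, here any scalars).
[cite: Markman2025SecantWeil, Example 8.2.3, v2 p. 53 L29–39] -/
def chOZ (a0 a1 a2 : K) : Theta4 K :=
  a0 • pt + a1 • chOW1 + a2 • chOW2 - (6 * (a2 * (a2 - 1) / 2)) • pt

section NoCharZero

/-- **[M] v2 p. 53 L4–14 (`n = 4`)**: for any `s` with `s² = −d`,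
`exp(sΘ) = (1 − d[W₂] + d²[pt]) + s·(Θ − d[W₁]) = α + s·β` (real part `α`, imaginary part `√d·β`).
[cite: Markman2025SecantWeil, Example 8.2.3, v2 p. 53 L4–14] -/
theorem exp_sqrt_neg (d s : K) (hs : s ^ 2 = -d) : exp s = alpha d + s • beta d := by
  ext <;> simp [alpha, beta]
  · linear_combination hs
  · linear_combination s * hs
  · linear_combination (s ^ 2 - d) * hs

/-- **[M] v2 p. 53 L20–28 and LEMMA 8.2.5**: the Euler characteristics carried by the input classes —
`χ(O_{W₁}) = ∫ch(O_{W₁}) = −3` («`= χ(O_C) = −3`», genus 4: `1 − 4`), `χ(O_{W₂}) = ∫ch(O_{W₂}) = 3`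
(«`h^{0,1}(C^{(2)}) = 4` and `h^{0,2}(C^{(2)}) = 6`»: `1 − 4 + 6 = 3`); HRR `χ = ∫ ch` on an abelian variety by value.
[cite: Markman2025SecantWeil, Example 8.2.3, v2 p. 53 L20–28] -/
theorem euler_characteristics_W1_W2 :
    integral (chOW1 : Theta4 K) = -3 ∧ (1 : ℤ) - 4 = -3 ∧
    integral (chOW2 : Theta4 K) = 3 ∧ (1 : ℤ) - 4 + 6 = 3 := by
  refine ⟨?_, by norm_num, ?_, by norm_num⟩ <;> simp [chOW1, chOW2, integral]

/-- **[M] (1.2.3), v2 p. 4 L5–13** for `n = 4`: the pairing `(s, t)_S = ∫_X τ(s) ∪ t` is SYMMETRIC on the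
`Θ`-subalgebra («symmetric for even `n`»), and `(x, x)_S = 2x₀x₄ − 8x₁x₃ + 6x₂²` in the coordinates `x = Σ x_j Θ^j/j!` —
the EULER FORM `χ(F, F) = ∫ ch(F^∨) ch(F)` of the tree file `HodgeTheory/SemiregularityEulerFormBarrier` (its
«Dictionary»), which is thereby this model's `∫ τ(x)·x`. [cite: Markman2025SecantWeil, (1.2.3), v2 p. 4 L5–13] -/
theorem mukaiPairing_four (x y : Theta4 K) :
    integral (tau x * y) = integral (tau y * x) ∧
    integral (tau x * x) = 2 * x.c0 * x.c4 - 8 * x.c1 * x.c3 + 6 * x.c2 ^ 2 := by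
  constructor <;> simp [integral] <;> ring

/-- **[M] v2 p. 53 L99–105** «`dim Ext²(F_d, F_d) = ∫_X ch(F_d)ch(F_d^∨) + 2 dim Ext¹(F_d, F_d) − 2 = 8d(d + 1) − 2
+ 2 dim Ext¹(F_d, F_d)`» for `F_d := I_Z(Θ)`, `ch(F_d) = α + β` (case `a₃ = 1`): the Euler pairing
`∫_X ch(F_d)·τ(ch F_d) = 8d(d+1)` (`ch(F^∨) = τ(ch F)`); for the class `α + a₃β` of `I_Z(a₃Θ)` it is `8d(a₃² + d)`
(= `HodgeTheory.SemiregularityEulerFormBarrier.eulerForm_twistedIdeal`, by `mukaiPairing_four`; the Serre-duality step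
«`dim Ext² = χ + 2 dim Ext¹ − 2`» is that file's `ext_two_eq_euler` and is not repeated here).
[cite: Markman2025SecantWeil, Example 8.2.3, v2 p. 53 L99–105] -/
theorem euler_pairing_Fd (d a3 : K) :
    integral ((alpha d + beta d) * tau (alpha d + beta d)) = 8 * d * (d + 1) ∧
    integral ((alpha d + a3 • beta d) * tau (alpha d + a3 • beta d)) = 8 * d * (a3 ^ 2 + d) := by
  constructor <;> simp [alpha, beta, integral] <;> ring

/-- The `a_k` of Example 8.2.3 are NUMBERS OF TRANSLATES (p. 52 L95–99, (8.2.1)), hence `≥ 0`: with the printed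
solution, `a₂ = d + a₃² > 0` and `a₀ = (a₃² + d)(6a₃² − 6a₃ + 2d) > 0` for every integer `a₃` and `d > 0`, while
`a₁ = 2(d + a₃²)(1 − a₃) ≥ 0` IFF `a₃ ≤ 1` — the arithmetic behind «We get a secant ideal sheaf tensored with `O_X(a₃Θ)`
for every choice of an integer `a₃ ≤ 1`» (p. 53 L95; the gloss «because `a₁ ≥ 0`» is the seat's reading, print states
the range only). [cite: Markman2025SecantWeil, Example 8.2.3, v2 p. 53 L86–96] -/
theorem multiplicities_nonneg_iff (d a3 : ℤ) (hd : 0 < d) :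
    0 < d + a3 ^ 2 ∧ 0 < (a3 ^ 2 + d) * (6 * a3 ^ 2 - 6 * a3 + 2 * d) ∧
    (0 ≤ 2 * (d + a3 ^ 2) * (1 - a3) ↔ a3 ≤ 1) := by
  have h1 : 0 < d + a3 ^ 2 := by positivity
  have h2 : 0 ≤ a3 ^ 2 - a3 := by nlinarith [sq_nonneg (a3 - 1), sq_nonneg a3]
  refine ⟨h1, mul_pos (by positivity) (by nlinarith), ?_⟩
  rw [mul_nonneg_iff_of_pos_left (by positivity)]
  omega

end NoCharZero

variable [CharZero K]

/-- Model sanity (genus 4): the powers of `Θ` in the divided-power basis, `∫[pt] = 1`, `∫Θ⁴ = 4! = 24`, the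
exponential series, and the printed intersection number «every such pair interests [sic] at `Θ⁴/4 = 6` points»
(`[W₂]·[W₂] = 6[pt]`). [cite: Markman2025SecantWeil, Example 8.2.3, v2 p. 52 L93–94 and p. 53 L18–19] -/
theorem model_sanity (c : K) :
    theta * theta = (thetaSq : Theta4 K) ∧ theta * thetaSq = (thetaCube : Theta4 K) ∧
    theta * thetaCube = (thetaFourth : Theta4 K) ∧ thetaSq * thetaSq = (thetaFourth : Theta4 K) ∧
    (W2 : Theta4 K) = (1 / 2 : K) • thetaSq ∧ (W1 : Theta4 K) = (1 / 6 : K) • thetaCube ∧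
    (pt : Theta4 K) = (1 / 24 : K) • thetaFourth ∧ theta * pt = (0 : Theta4 K) ∧
    integral (pt : Theta4 K) = 1 ∧ integral (thetaFourth : Theta4 K) = 24 ∧
    W2 * W2 = (6 : K) • (pt : Theta4 K) ∧ integral ((1 / 4 : K) • (thetaFourth : Theta4 K)) = 6 ∧
    exp c = 1 + c • theta + (c ^ 2 / 2) • thetaSq + (c ^ 3 / 6) • thetaCube + (c ^ 4 / 24) • thetaFourth := by
  refine ⟨?_, ?_, ?_, ?_, ?_, ?_, ?_, ?_, rfl, rfl, ?_, ?_, ?_⟩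
  all_goals first | (ext <;> simp <;> ring) | (simp [integral]; norm_num)

/-- **[M] LEMMA 8.2.5, (8.2.4), v2 p. 55 L54–62** «`χ(O_{W₂}(−Θ)) = ∫_X (Θ²/2 + λΘ³ + 3[pt])(1 − Θ + Θ²/2 − Θ³/6 +
Θ⁴/24) = 9 − 24λ`» (`ch(O_X(−Θ)) = exp(−Θ)`), with p. 56 L10–13: «`χ(O_{W₂ ∩ τ(Θ)}) = χ(O_{C₁}) + χ(O_{C₂}) +
χ(O_{C₃}) − 5 = −14`», «`χ(O_{W₂}(−τ(Θ))) = χ(O_{W₂}) − χ(O_{W₂ ∩ τ(Θ)}) = 17`», «`9 − 24λ = 17`, so `λ = −1/3`»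
(`χ(O_{C_j}) = −3`, `χ(O_{W₂}) = 3` by value; the `5 = 1 + 2 + 2` intersection points of p. 56 L5–9; p. 55 L72–74 «The
intersection has cohomology class `Θ³/2`. It consists of the union of three irreducible components of class `Θ³/6`
each.»: `[W₂]·Θ = 3·[W₁]`) — hence `ch(O_{W₂}) = Θ²/2 − Θ³/3 + 3[pt]`.
[cite: Markman2025SecantWeil, Lemma 8.2.5, v2 p. 55 L52–74 and p. 56 L5–13] -/
theorem lemma_8_2_5 (lam : K) :
    exp (-1) = (1 : Theta4 K) - theta + (1 / 2 : K) • thetaSq - (1 / 6 : K) • thetaCube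
      + (1 / 24 : K) • thetaFourth ∧
    integral ((((1 / 2 : K) • thetaSq + lam • thetaCube + (3 : K) • pt) : Theta4 K) * exp (-1))
      = 9 - 24 * lam ∧
    (W2 * theta = (3 : K) • (W1 : Theta4 K)) ∧
    ((1 : ℤ) + 2 + 2 = 5 ∧ (-3 : ℤ) + (-3) + (-3) - 5 = -14 ∧ (3 : ℤ) - (-14) = 17) ∧
    (9 - 24 * lam = 17 ↔ lam = -1 / 3) ∧
    (1 / 2 : K) • thetaSq + (-1 / 3 : K) • thetaCube + (3 : K) • pt = (chOW2 : Theta4 K) := by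
  refine ⟨?_, ?_, ?_, ⟨by norm_num, by norm_num, by norm_num⟩, ?_, ?_⟩
  · ext <;> simp <;> ring
  · simp [integral]; ring
  · ext <;> simp
  · constructor
    · intro h; linear_combination (-1 / 24 : K) * h
    · intro h; linear_combination (-24 : K) * h
  · ext <;> simp [chOW2]
    ring

/-- **[M] v2 p. 53 L40–56** «`ch(I_Z) = 1 − (a₂/2)Θ² + ((2a₂ − a₁)/6)Θ³ + (6·binom(a₂,2) − 3a₂ + 3a₁ − a₀)[pt]`»
from `ch(I_Z) = 1 − ch(O_Z)` and the displayed `ch(O_Z)`.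
[cite: Markman2025SecantWeil, Example 8.2.3, v2 p. 53 L29–56] -/
theorem ch_IZ (a0 a1 a2 : K) :
    1 - chOZ a0 a1 a2 = (1 : Theta4 K) - (a2 / 2) • thetaSq + ((2 * a2 - a1) / 6) • thetaCube
      + (6 * (a2 * (a2 - 1) / 2) - 3 * a2 + 3 * a1 - a0) • pt := by
  ext <;> simp [chOZ, chOW1, chOW2] <;> ring

/-- **[M] v2 p. 53 L57–80** «`ch(I_Z(a₃Θ)) = 1 + a₃Θ + ((a₃² − a₂)/2)Θ² + ((a₃³ − 3a₃a₂ + 2a₂ − a₁)/6)Θ³ +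
(a₃⁴ − 6a₂a₃² + 8a₂a₃ − 4a₁a₃ + 6·binom(a₂,2) − 3a₂ + 3a₁ − a₀)[pt]`» = `ch(I_Z)·exp(a₃Θ)`.
[cite: Markman2025SecantWeil, Example 8.2.3, v2 p. 53 L57–80] -/
theorem ch_IZ_twist (a0 a1 a2 a3 : K) :
    (1 - chOZ a0 a1 a2) * exp a3 = (1 : Theta4 K) + a3 • theta + ((a3 ^ 2 - a2) / 2) • thetaSq
      + ((a3 ^ 3 - 3 * a3 * a2 + 2 * a2 - a1) / 6) • thetaCube
      + (a3 ^ 4 - 6 * a2 * a3 ^ 2 + 8 * a2 * a3 - 4 * a1 * a3 + 6 * (a2 * (a2 - 1) / 2)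
          - 3 * a2 + 3 * a1 - a0) • pt := by
  ext <;> simp [chOZ, chOW1, chOW2] <;> ring

/-- **[M] v2 p. 53 L81–85** «`α + a₃β = 1 + a₃Θ − (d/2)Θ² − (da₃/6)Θ³ + d²[pt]`».
[cite: Markman2025SecantWeil, Example 8.2.3, v2 p. 53 L81–85] -/
theorem alpha_add_smul_beta (d a3 : K) :
    alpha d + a3 • beta d = (1 : Theta4 K) + a3 • theta - (d / 2) • thetaSq - (d * a3 / 6) • thetaCube
      + (d ^ 2) • pt := by
  ext <;> simp [alpha, beta]
  ring

/-- **[M] v2 p. 53 L86–94, «Comparing coefficients in Equation 8.2.2»** — as an equivalence: (8.2.2)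
`ch(I_Z(a₃Θ)) = α + a₃β` holds IFF `a₂ = d + a₃²`, `a₁ = 2(d + a₃²)(1 − a₃)` and
`a₀ = 6a₃⁴ − 6a₃³ + 8da₃² − 6da₃ + 2d²`; and the printed factorisation `= (a₃² + d)(6a₃² − 6a₃ + 2d)`.
[cite: Markman2025SecantWeil, Example 8.2.3, v2 p. 53 L86–94] -/
theorem eq_8_2_2_iff (d a0 a1 a2 a3 : K) :
    ((1 - chOZ a0 a1 a2) * exp a3 = alpha d + a3 • beta d ↔
      (a2 = d + a3 ^ 2 ∧ a1 = 2 * (d + a3 ^ 2) * (1 - a3) ∧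
       a0 = 6 * a3 ^ 4 - 6 * a3 ^ 3 + 8 * d * a3 ^ 2 - 6 * d * a3 + 2 * d ^ 2)) ∧
    (6 * a3 ^ 4 - 6 * a3 ^ 3 + 8 * d * a3 ^ 2 - 6 * d * a3 + 2 * d ^ 2
      = (a3 ^ 2 + d) * (6 * a3 ^ 2 - 6 * a3 + 2 * d)) := by
  refine ⟨?_, by ring⟩
  rw [ch_IZ_twist, alpha_add_smul_beta, Theta4.ext_iff]
  simp only [add_c0, add_c1, add_c2, add_c3, add_c4, sub_c0, sub_c1, sub_c2, sub_c3, sub_c4,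
    smul_c0, smul_c1, smul_c2, smul_c3, smul_c4, one_c0, one_c1, one_c2, one_c3, one_c4,
    theta_c0, theta_c1, theta_c2, theta_c3, theta_c4, thetaSq_c0, thetaSq_c1, thetaSq_c2, thetaSq_c3,
    thetaSq_c4, thetaCube_c0, thetaCube_c1, thetaCube_c2, thetaCube_c3, thetaCube_c4,
    pt_c0, pt_c1, pt_c2, pt_c3, pt_c4, mul_zero, mul_one, add_zero, sub_zero, zero_add]
  constructor
  · rintro ⟨-, -, h2, h3, h4⟩
    have ha2 : a2 = d + a3 ^ 2 := by linear_combination (-1 : K) * h2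
    subst ha2
    have ha1 : a1 = 2 * (d + a3 ^ 2) * (1 - a3) := by linear_combination (-1 : K) * h3
    subst ha1
    exact ⟨rfl, rfl, by linear_combination (-1 : K) * h4⟩
  · rintro ⟨rfl, rfl, rfl⟩
    refine ⟨trivial, trivial, ?_, ?_, ?_⟩ <;> ring

/-- **[M] v2 p. 53 L96** «If we choose `a₃ = 1`, then `a₂ = d + 1`, `a₁ = 0`, and `a₀ = 2d(d + 1)`.»: the case
`a₃ = 1` of (8.2.2), i.e. `ch(I_Z(Θ)) = α + β`.
[cite: Markman2025SecantWeil, Example 8.2.3, v2 p. 53 L95–96] -/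
theorem eq_8_2_2_a3_one (d a0 a1 a2 : K) :
    (1 - chOZ a0 a1 a2) * exp 1 = alpha d + beta d ↔
      (a2 = d + 1 ∧ a1 = 0 ∧ a0 = 2 * d * (d + 1)) := by
  have h1 : (1 : K) • beta d = beta d := by ext <;> simp
  have h := (eq_8_2_2_iff d a0 a1 a2 1).1
  rw [h1] at h
  rw [h]
  constructor
  · rintro ⟨h2, h1, h0⟩
    exact ⟨by linear_combination h2, by linear_combination h1, by linear_combination h0⟩
  · rintro ⟨h2, h1, h0⟩
    exact ⟨by linear_combination h2, by linear_combination h1, by linear_combination h0⟩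

end Theta4

/-! ## [M] §8.1 (v2 p. 50 L66 – p. 51 L70): the general `K`-secant pure spinors `(α + τ√−d β)/qⁿ = exp(kΘ)`,
`k = (ρ + τ√−d)/q`, for `n = 2, 3, 4`, and the printed case list for `χ(F^∨ ⊗ F)`; one PRINT ERRATUM certified

[M] v2 p. 50 L66–69 / p. 51 L3–39 (by eye, 170-dpi render): «If `K = ℚ(√−d)`, `d` a positive integer, and we write
`k = (ρ + τ√−d)/q`, with `ρ, τ, q ∈ ℤ`, `gcd(ρ, τ, q) = 1`, `q > 0`, and `τ ≠ 0`, then the non-rational pure spinors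
defined over `K` in Lemma 8.1.1 are enumerated by `(α + τ√−dβ)/qⁿ`, where
`α = qⁿ + ρq^{n−1}Θ + q^{n−2}(ρ² − τ²d)Θ²/2 + q^{n−3}ρ(ρ² − 3τ²d)Θ³/3! + q^{n−4}(ρ⁴ − 6ρ²τ²d + τ⁴d²)Θ⁴/4! + …
 = exp((ρ/q)Θ) Σ_{j=0}^{⌊n/2⌋} (−1)^j q^{n−2j}(τ²d)^j Θ^{2j}/(2j)!`,
`β = q^{n−1}Θ + ρq^{n−2}Θ² + q^{n−3}(3ρ² − dτ²)Θ³/3! + q^{n−4}ρ(ρ² − τ²d)Θ⁴/4! + …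
 = exp((ρ/q)Θ) Σ_{j=0}^{⌊(n−1)/2⌋} (−1)^j q^{n−1−2j}(τ²d)^j Θ^{2j+1}/(2j+1)!`
and `α, β ∈ H^{ev}(X, ℤ)`.»; p. 51 L42–70: «If `aα + bβ` is the Chern character of an object `F ∈ D^b(X)`, then
`χ(F^∨ ⊗ F) = ∫_X (aα + bβ)^∨(aα + bβ) =` `0` if `n` is odd, `−2q²(a²τ²d + b²)` if `n = 2`, `8dq⁴τ²(a²τ²d + b²)`
if `n = 4`, `(−1)^{n/2} 2^{n−1} d^{n/2−1} qⁿ τ^{n−2}(a²τ²d + b²)` if `n` is even.»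

PRINT ERRATUM (certified below, `Theta4.closedForm_beta` / `pureSpinor_coordinates`): in the first display line for
`β` the `Θ⁴`-term «`q^{n−4}ρ(ρ² − τ²d)Θ⁴/4!`» disagrees with `β`'s own closed form `exp((ρ/q)Θ)·Σ_j …` on the next
line, which gives `q^{n−4}ρ(ρ² − τ²d)Θ⁴/3!` (= `4ρ(ρ² − τ²d)·q^{n−4}` on the basis vector `Θ⁴/4!`); the expansion of
`qⁿ·exp(kΘ)` confirms the closed form. The tree file `HodgeTheory/SemiregularityEulerFormBarrier` records the same
correction (`eulerForm_secant_markman`, `eulerForm_markman_printed_display_fails`); here it is re-derived from the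
definition `(α + τ√−dβ)/qⁿ = exp(kΘ)` in the model. (Note also that the same display writes the `Θ²`-term of `β` as
«`ρq^{n−2}Θ²`», i.e. `2ρq^{n−2}·Θ²/2!`, consistently.) Nothing else in §8.1 is affected; no cell word depends on it. -/

/-- Coordinates `(c0, c1, c2) ↔ c0·1 + c1·Θ + c2·Θ²/2!` in the `Θ`-subalgebra of `H^{2•}(X, K)`, `(X, Θ)` a
principally polarized abelian SURFACE (`Θ²/2! = [pt]`), for the `n = 2` line of [M] p. 51 L58–60.
[cite: Markman2025SecantWeil, §8.1, v2 p. 51 L42–70] -/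
@[ext] structure Theta2 (K : Type*) where
  /-- coefficient of `1` -/
  c0 : K
  /-- coefficient of `Θ` -/
  c1 : K
  /-- coefficient of `Θ²/2! = [pt]` -/
  c2 : K

namespace Theta2

variable {K : Type*}

/-- `∫_X` : the `[pt]`-coordinate. [folklore] -/
def integral (x : Theta2 K) : K := x.c2

variable [Field K]

/-- sum of classes -/
@[simps] instance : Add (Theta2 K) := ⟨fun x y => ⟨x.c0 + y.c0, x.c1 + y.c1, x.c2 + y.c2⟩⟩
/-- scalars -/
@[simps] instance : SMul K (Theta2 K) := ⟨fun a x => ⟨a * x.c0, a * x.c1, a * x.c2⟩⟩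
/-- cup product in the divided-power basis (`Θ·Θ = 2·(Θ²/2!)`, `Θ³ = 0`). -/
@[simps] instance : Mul (Theta2 K) := ⟨fun x y => ⟨x.c0 * y.c0, x.c0 * y.c1 + x.c1 * y.c0,
    x.c0 * y.c2 + 2 * (x.c1 * y.c1) + x.c2 * y.c0⟩⟩
/-- [M] (1.2.3) on even degrees: `(−1)^j` on `H^{2j}`. [cite: Markman2025SecantWeil, (1.2.3), v2 p. 4 L8–13] -/
@[simps] def tau (x : Theta2 K) : Theta2 K := ⟨x.c0, -x.c1, x.c2⟩
/-- `exp(cΘ) = 1 + cΘ + c²Θ²/2!`. [folklore] -/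
@[simps] def exp (c : K) : Theta2 K := ⟨1, c, c ^ 2⟩
/-- [M] p. 51 L8, `n = 2`: `α = q² + ρqΘ + (ρ² − τ²d)Θ²/2`. [cite: Markman2025SecantWeil, §8.1, v2 p. 51 L6–12] -/
@[simps] def alphaGen (ρ τ q d : K) : Theta2 K := ⟨q ^ 2, ρ * q, ρ ^ 2 - τ ^ 2 * d⟩
/-- [M] p. 51 L25, `n = 2`: `β = qΘ + ρΘ²` (= `2ρ·Θ²/2!`). [cite: Markman2025SecantWeil, §8.1, v2 p. 51 L23–27] -/
@[simps] def betaGen (ρ q : K) : Theta2 K := ⟨0, q, 2 * ρ⟩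

/-- **[M] §8.1, `n = 2`**: `q²·exp(kΘ) = α + τ√−d·β` for `qk = ρ + τ√−d` (any `s` with `s² = −d` in place of
`√−d`), and the printed Euler pairing «`−2q²(a²τ²d + b²)` if `n = 2`» for the class `aα + bβ`; the pairing
(1.2.3) is symmetric («symmetric for even `n`»). [cite: Markman2025SecantWeil, §8.1, v2 p. 51 L3–39 and L42–60] -/
theorem pureSpinor_coordinates (ρ τ q d s k a b : K) (hs : s ^ 2 = -d) (hk : q * k = ρ + τ * s) :
    (q ^ 2) • exp k = alphaGen ρ τ q d + (τ * s) • betaGen ρ q ∧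
    integral (tau (a • alphaGen ρ τ q d + b • betaGen ρ q) * (a • alphaGen ρ τ q d + b • betaGen ρ q))
      = -2 * q ^ 2 * (a ^ 2 * τ ^ 2 * d + b ^ 2) ∧
    (∀ x y : Theta2 K, integral (tau x * y) = integral (tau y * x)) := by
  refine ⟨?_, ?_, fun x y => ?_⟩
  · ext <;> simp
    · linear_combination q * hk
    · linear_combination (q * k + (ρ + τ * s)) * hk + τ ^ 2 * hs
  · simp [integral]; ring
  · simp [integral]; ring

end Theta2

namespace Theta3

variable {K : Type*} [Field K]

/-- [M] p. 51 L6–12, `n = 3`, in the coordinates `Θ^j/j!`: `α = (q³, ρq², q(ρ² − τ²d), ρ(ρ² − 3τ²d))`.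
[cite: Markman2025SecantWeil, §8.1, v2 p. 51 L6–12] -/
@[simps] def alphaGen (ρ τ q d : K) : Theta3 K := ⟨q ^ 3, ρ * q ^ 2, q * (ρ ^ 2 - τ ^ 2 * d), ρ * (ρ ^ 2 - 3 * τ ^ 2 * d)⟩
/-- [M] p. 51 L23–27, `n = 3`: `β = q²Θ + ρqΘ² + (3ρ² − dτ²)Θ³/3!` = `(0, q², 2ρq, 3ρ² − dτ²)` in the coordinates `Θ^j/j!`.
[cite: Markman2025SecantWeil, §8.1, v2 p. 51 L23–27] -/
@[simps] def betaGen (ρ τ q d : K) : Theta3 K := ⟨0, q ^ 2, 2 * ρ * q, 3 * ρ ^ 2 - d * τ ^ 2⟩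

/-- **[M] §8.1, `n = 3`**: `q³·exp(kΘ) = α + τ√−d·β` for `qk = ρ + τ√−d`, and «`χ(F^∨ ⊗ F) = 0` if `n` is odd» for
every class `aα + bβ` (indeed for every class: `mukaiPairing_three`). The secant plane of §8.2 is the case
`(ρ, τ, q) = (0, 1, 1)`: `alphaGen 0 1 1 d = α`, `betaGen 0 1 1 d = β` of Lemma 8.2.1.
[cite: Markman2025SecantWeil, §8.1, v2 p. 51 L3–39 and L42–57] -/
theorem pureSpinor_coordinates [CharZero K] (ρ τ q d s k a b : K) (hs : s ^ 2 = -d) (hk : q * k = ρ + τ * s) :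
    (q ^ 3) • exp k = alphaGen ρ τ q d + (τ * s) • betaGen ρ τ q d ∧
    integral (tau (a • alphaGen ρ τ q d + b • betaGen ρ τ q d) * (a • alphaGen ρ τ q d + b • betaGen ρ τ q d))
      = 0 ∧
    alphaGen 0 1 1 d = alpha d ∧ betaGen 0 1 1 d = beta d := by
  refine ⟨?_, (mukaiPairing_three (a • alphaGen ρ τ q d + b • betaGen ρ τ q d) 0).2, ?_, ?_⟩
  · ext <;> simp
    · linear_combination q ^ 2 * hk
    · linear_combination (q * (q * k + (ρ + τ * s))) * hk + (q * τ ^ 2) * hs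
    · linear_combination ((q * k) ^ 2 + q * k * (ρ + τ * s) + (ρ + τ * s) ^ 2) * hk
        + (3 * ρ * τ ^ 2 + τ ^ 3 * s) * hs
  · ext <;> simp [alpha]
  · ext <;> simp [beta]

end Theta3

namespace Theta4

variable {K : Type*} [Field K]

/-- [M] p. 51 L6–12, `n = 4`, in the coordinates `Θ^j/j!`:
`α = (q⁴, ρq³, q²(ρ² − τ²d), qρ(ρ² − 3τ²d), ρ⁴ − 6ρ²τ²d + τ⁴d²)` — exactly as printed.
[cite: Markman2025SecantWeil, §8.1, v2 p. 51 L6–12] -/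
@[simps] def alphaGen (ρ τ q d : K) : Theta4 K :=
  ⟨q ^ 4, ρ * q ^ 3, q ^ 2 * (ρ ^ 2 - τ ^ 2 * d), q * ρ * (ρ ^ 2 - 3 * τ ^ 2 * d),
    ρ ^ 4 - 6 * ρ ^ 2 * τ ^ 2 * d + τ ^ 4 * d ^ 2⟩
/-- [M] p. 51 L23–27, `n = 4`, in the coordinates `Θ^j/j!`: `β = (0, q³, 2ρq², q(3ρ² − dτ²), 4ρ(ρ² − τ²d))` — the
last entry as given by the printed CLOSED FORM `exp((ρ/q)Θ)·(q³Θ − qτ²d·Θ³/3!)` (= `ρ(ρ² − τ²d)·Θ⁴/3!`); the first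
display line prints «`ρ(ρ² − τ²d)Θ⁴/4!`» there (PRINT ERRATUM, see `closedForm_beta`, `printedDisplay_beta_theta4`).
[cite: Markman2025SecantWeil, §8.1, v2 p. 51 L23–39] -/
@[simps] def betaGen (ρ τ q d : K) : Theta4 K :=
  ⟨0, q ^ 3, 2 * ρ * q ^ 2, q * (3 * ρ ^ 2 - d * τ ^ 2), 4 * ρ * (ρ ^ 2 - τ ^ 2 * d)⟩

/-- **[M] §8.1, `n = 4`: `q⁴·exp(kΘ) = α + τ√−d·β`** for `qk = ρ + τ√−d` (any `s` with `s² = −d`), with `β`'s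
`Θ⁴/4!`-coordinate `4ρ(ρ² − τ²d)`; and the secant plane of Example 8.2.3 is `(ρ, τ, q) = (0, 1, 1)`.
[cite: Markman2025SecantWeil, §8.1, v2 p. 51 L3–39] -/
theorem pureSpinor_coordinates (ρ τ q d s k : K) (hs : s ^ 2 = -d) (hk : q * k = ρ + τ * s) :
    (q ^ 4) • exp k = alphaGen ρ τ q d + (τ * s) • betaGen ρ τ q d ∧
    alphaGen 0 1 1 d = alpha d ∧ betaGen 0 1 1 d = beta d := by
  refine ⟨?_, ?_, ?_⟩
  · ext <;> simp
    · linear_combination q ^ 3 * hk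
    · linear_combination (q ^ 2 * (q * k + (ρ + τ * s))) * hk + (q ^ 2 * τ ^ 2) * hs
    · linear_combination (q * ((q * k) ^ 2 + q * k * (ρ + τ * s) + (ρ + τ * s) ^ 2)) * hk
        + (q * (3 * ρ * τ ^ 2 + τ ^ 3 * s)) * hs
    · linear_combination ((q * k) ^ 3 + (q * k) ^ 2 * (ρ + τ * s) + q * k * (ρ + τ * s) ^ 2 + (ρ + τ * s) ^ 3) * hk
        + (6 * ρ ^ 2 * τ ^ 2 + 4 * ρ * τ ^ 3 * s + τ ^ 4 * (s ^ 2 - d)) * hs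
  · ext <;> simp [alpha]
  · ext <;> simp [beta]

/-- **The printed CLOSED FORMS, `n = 4`** (p. 51 L13–22 and L28–39): `α = exp((ρ/q)Θ)·(q⁴ − q²τ²d·Θ²/2! + τ⁴d²·Θ⁴/4!)`
and `β = exp((ρ/q)Θ)·(q³Θ − qτ²d·Θ³/3!)` (for `q ≠ 0`) — both equal the coordinate vectors `alphaGen`, `betaGen`; in
particular the closed form of `β` has `Θ⁴/4!`-coordinate `4ρ(ρ² − τ²d)`, i.e. its `Θ⁴`-term is `ρ(ρ² − τ²d)Θ⁴/3!`.
[cite: Markman2025SecantWeil, §8.1, v2 p. 51 L13–39] -/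
theorem closedForm_beta (ρ τ q d : K) (hq : q ≠ 0) :
    exp (ρ / q) * (⟨q ^ 4, 0, -(q ^ 2 * τ ^ 2 * d), 0, τ ^ 4 * d ^ 2⟩ : Theta4 K) = alphaGen ρ τ q d ∧
    exp (ρ / q) * (⟨0, q ^ 3, 0, -(q * τ ^ 2 * d), 0⟩ : Theta4 K) = betaGen ρ τ q d ∧
    (betaGen ρ τ q d).c4 = 4 * ρ * (ρ ^ 2 - τ ^ 2 * d) := by
  refine ⟨?_, ?_, rfl⟩
  · ext <;> simp <;> field_simp <;> ring
  · ext <;> simp <;> field_simp <;> ring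

/-- **PRINT ERRATUM, certified**: reading the first display line of `β` literally (`Θ⁴/4!`-coordinate
`ρ(ρ² − τ²d)·q^{n−4}`) contradicts `q⁴·exp(kΘ) = α + τ√−dβ` — e.g. `(ρ, τ, q, d) = (2, 1, 1, 1)`, `k = 2 + i`:
`k⁴ = −7 + 24i`, the `Θ⁴/4!`-coordinate of `α + iβ` must be `−7 + 24i`, so `β`'s is `24 = 4ρ(ρ² − τ²d)`, not
`6 = ρ(ρ² − τ²d)`; the two readings agree only when `ρ(ρ² − τ²d) = 0`. (Same correction as
`HodgeTheory.SemiregularityEulerFormBarrier.eulerForm_markman_printed_display_fails`.)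
[cite: Markman2025SecantWeil, §8.1, v2 p. 51 L23–27 (display) vs L28–39 (closed form)] -/
theorem printedDisplay_beta_theta4 :
    (2 : ℤ) ^ 4 - 6 * 2 ^ 2 * 1 ^ 2 * 1 + 1 ^ 4 * 1 ^ 2 = -7 ∧ (4 : ℤ) * 2 * (2 ^ 2 - 1 ^ 2 * 1) = 24 ∧
    (2 : ℤ) * (2 ^ 2 - 1 ^ 2 * 1) = 6 ∧ (24 : ℤ) ≠ 6 ∧
    (∀ ρ τ d : ℤ, 4 * ρ * (ρ ^ 2 - τ ^ 2 * d) = ρ * (ρ ^ 2 - τ ^ 2 * d) ↔ ρ * (ρ ^ 2 - τ ^ 2 * d) = 0) := by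
  refine ⟨by norm_num, by norm_num, by norm_num, by norm_num, fun ρ τ d => ⟨fun h => ?_, fun h => ?_⟩⟩
  · have h3 : 3 * (ρ * (ρ ^ 2 - τ ^ 2 * d)) = 0 := by linear_combination h
    exact (mul_eq_zero.mp h3).resolve_left (by norm_num)
  · linear_combination 3 * h

/-- **[M] p. 51 L42–70, `n = 4`** «`χ(F^∨ ⊗ F) = ∫_X (aα + bβ)^∨(aα + bβ) = 8dq⁴τ²(a²τ²d + b²)` if `n = 4`» and the
`n`-even master formula at `n = 4` (`(−1)² 2³ d¹ q⁴ τ² (a²τ²d + b²)`), computed in the model with `ch(F^∨) = τ(ch F)`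
(= `HodgeTheory.SemiregularityEulerFormBarrier.eulerForm_secant_markman`, there a bare polynomial identity).
[cite: Markman2025SecantWeil, §8.1, v2 p. 51 L42–70] -/
theorem chi_secant (ρ τ q d a b : K) :
    integral (tau (a • alphaGen ρ τ q d + b • betaGen ρ τ q d) * (a • alphaGen ρ τ q d + b • betaGen ρ τ q d))
      = 8 * d * q ^ 4 * τ ^ 2 * (a ^ 2 * τ ^ 2 * d + b ^ 2) ∧
    (-1 : K) ^ (4 / 2) * 2 ^ (4 - 1) * d ^ (4 / 2 - 1) * q ^ 4 * τ ^ (4 - 2) * (a ^ 2 * τ ^ 2 * d + b ^ 2)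
      = 8 * d * q ^ 4 * τ ^ 2 * (a ^ 2 * τ ^ 2 * d + b ^ 2) := by
  constructor
  · simp [integral]; ring
  · norm_num

end Theta4

end Literature.AlgebraicGeometry.Markman2025
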